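import Literature.NumberTheory.Rogawski1990.LocalTransferUnmatchedLocus                 -- ★ p840418 (J-e-1) + through it ★ p840336 matched∕unmatched chart, ★ p840239 boxes
import Literature.NumberTheory.Rogawski1990.LocalTransferGlueCM                        -- ★ p839896: `exists_localTransfer_of_cover`, `localStableOrbitalIntegralH_add_of_isLocSmooth`
import Literature.NumberTheory.Rogawski1990.FinExplicitTransferFactorEventuallyConstFamily  -- ★ p840324 B-p04 (G1-ii)
import Literature.NumberTheory.Rogawski1990.FinExplicitTransferFactorStableInvariance   -- ★ p839998 B-p10 (iv-d) `finExplicitCollection_Δ_eq_of_isLocalStablyConjH`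
import Literature.NumberTheory.Rogawski1990.FinExplicitTransferFactorNondegenerate      -- ★ `isUnit_eval_finCharpolyTwo_of_isLocalGRegular`
import Literature.NumberTheory.Rogawski1990.LocalNormFibreTorusUniform                 -- ★ p840559 p08 (W2′) `exists_mem_forall_isLocalStablyConjH_of_conj_eq` (+ ★ p840359 (F1)–(F3))
import Literature.NumberTheory.Rogawski1990.LocalCentralizerTorusMeasureCM             -- ★ p840488 B-p04 (o3) `exists_isHaarMeasure_isInvInvariant_compactCore_eq_one`
import Literature.NumberTheory.Rogawski1990.EndoscopicCentralizerIso                   -- ★ `exists_localEndoCentralizerEquiv` (Θ)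
import HarnessLib

/-!
# THE (HLOC) JUNCTION AT THE CM CARRIERS — the MATCHED CHART at a non-split place: transfer of every `ψ ∈ C_c^∞(U(H′)(L⁺_v))` supported in a
# regular `U(H′)`-chart around a matched class, over the norm fibre's `k ≤ 3` re-coordinatised `H`-boxes (design v2; Rogawski 1990 §4.3, §4.9)

Topic `NumberTheory/Rogawski1990`; namespace `Literature.NumberTheory.Rogawski1990`.  THEOREMS ONLY (no definition, no instance, no notation, no named fact, no `sorry`).
Cell `pub/hodgecm-mathlib` (D-0151), crux H413 = stmt-HodgeConjecture-24833, F0∕P3a road «D-N6-ns», floor-2 letter N6-ns-reg, THE ONE junction file (LEAD F0P3a-plan (g9) T8-25 (B));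
seat F0P2-p02 (g8).  HYPOTHESIS-DRIVEN EDITION: the chart data (A-p16 (g26) (1ᵀ)∕(2ᵀ)), the torus local constancy of orbital integrals (F0P3a-p03 (g10) (G1-i)), the uniform
fibre (F0P3a-p08 (g13) (W2′)) and the torus Haar normalisation (p08 (o3)) enter as EXPLICIT BINDERS in the shapes of record (F0P2-p02 spec 02:43:45Z ∕ design v2 02:59:39Z; the uniform fibre (W2′) p840559 and the torus measures (o3) p840488 are ★);
everything else is ★ BY NAME.  HONEST LABEL: HC_CM is proved only modulo the printed citations until rung 0 closes; this file proves no letter.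

* §1 two bookkeeping lemmas on the `G′`-torus `Tc = Z_{G′_v}(γ₀′)`: matching along the transport `θ_t` (★ `exists_localEndoCentralizerEquiv`), and «two box points matched by
  one `γ_H` coincide» from the chart's (SEP).
* §2 `exists_localTransfer_of_matchedChart_nonsplit` — THE MATCHED CHART at CM (★ `exists_transfer_of_matchedChart` fed by ★ (G1-ii) p840324, ★ (iv-d) p839998, ★ F1–F3 p840359,
  ★ (Θ), ★ `…_of_chart_comp` p840442, and the binders above).
* The HEADLINE (T1) «N6-ns-reg» (cover = matched charts §2 ∪ the open unmatched locus ★ p840418, glue ★ p839896) is `LocalTransferRegularSupportNonsplitCM.lean`.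

## References
* [Rogawski1990] J. Rogawski, *Automorphic Representations of Unitary Groups in Three Variables*, Ann. of Math. Stud. 123 (1990): §4.3 (4.3.1)–(4.3.2) pp. 42–44; §4.9 Prop. 4.9.1 (a) pp. 54–55; §3.6.
* [LanglandsShelstad1987] R. P. Langlands, D. Shelstad, Math. Ann. 278 (1987): §1.3.  [HarishChandra1970] LNM 162, Part I §3.
-/

set_option autoImplicit false

noncomputable section

open Set Filter Topology MeasureTheory Polynomial
open scoped Pointwise Matrix

namespace Literature.NumberTheory.Rogawski1990

open Literature.NumberTheory.Automorphic Literature.NumberTheory.Automorphic.UnitaryGroup Literature.NumberTheory.GaloisRepresentations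
open _root_.NumberField _root_.IsDedekindDomain

section MatchedCM

variable (L : Type) [Field L] [NumberField L] [IsCMField L] (H' : Matrix (Fin 3) (Fin 3) L) (v : HeightOneSpectrum (𝓞 ↥(maximalRealSubfield L)))

/-! ## §1 Bookkeeping on the `G′`-torus -/

/-- **The transport formula read backwards**: `y · ι(θ⁻¹(b)) · y⁻¹ = b` for `b ∈ Z_{G′}(γ₀)`. [cite: Rogawski1990, §4.3 pp. 42–44] -/
theorem conj_endoEmbLocal_symm_eq_of_transport
    {t : (cmDatum L 2 (Matrix.of fun i j : Fin 2 => if i.val + j.val + 1 = 2 then (1 : L) else 0)).Local v ×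
      (cmDatum L 1 (Matrix.of fun i j : Fin 1 => if i.val + j.val + 1 = 1 then (1 : L) else 0)).Local v}
    {γ₀ : (cmDatum L 3 H').Local v}
    (θ : ↥(Subgroup.centralizer ({t} : Set ((cmDatum L 2 (Matrix.of fun i j : Fin 2 => if i.val + j.val + 1 = 2 then (1 : L) else 0)).Local v ×
        (cmDatum L 1 (Matrix.of fun i j : Fin 1 => if i.val + j.val + 1 = 1 then (1 : L) else 0)).Local v))) ≃ₜ*
      ↥(Subgroup.centralizer ({γ₀} : Set ((cmDatum L 3 H').Local v))))
    (y : GL (Fin 3) (LocalRing L v))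
    (hθ : ∀ z, ((θ z).1.val : GL (Fin 3) (LocalRing L v)) = y * ((endoEmbLocal L v z.1).val : GL (Fin 3) (LocalRing L v)) * y⁻¹)
    (b : ↥(Subgroup.centralizer ({γ₀} : Set ((cmDatum L 3 H').Local v)))) :
    y * ((endoEmbLocal L v (θ.symm b).1).val : GL (Fin 3) (LocalRing L v)) * y⁻¹ = (b.1.val : GL (Fin 3) (LocalRing L v)) := by
  have h := hθ (θ.symm b)
  rw [ContinuousMulEquiv.apply_symm_apply] at h
  exact h.symm

/-- **Matching along the transport**: if `(θ z).val = y · ι(z) · y⁻¹` for all `z ∈ Z_H(t)` then `θ⁻¹(b)` matches `b` for every `b ∈ Z_{G′}(γ₀′)`. [cite: Rogawski1990, §4.3 pp. 42–44] -/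
theorem isLocalNormPair_symm_of_transport
    {t : (cmDatum L 2 (Matrix.of fun i j : Fin 2 => if i.val + j.val + 1 = 2 then (1 : L) else 0)).Local v ×
      (cmDatum L 1 (Matrix.of fun i j : Fin 1 => if i.val + j.val + 1 = 1 then (1 : L) else 0)).Local v}
    {γ₀ : (cmDatum L 3 H').Local v}
    (θ : ↥(Subgroup.centralizer ({t} : Set ((cmDatum L 2 (Matrix.of fun i j : Fin 2 => if i.val + j.val + 1 = 2 then (1 : L) else 0)).Local v ×
        (cmDatum L 1 (Matrix.of fun i j : Fin 1 => if i.val + j.val + 1 = 1 then (1 : L) else 0)).Local v))) ≃ₜ*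
      ↥(Subgroup.centralizer ({γ₀} : Set ((cmDatum L 3 H').Local v))))
    (y : GL (Fin 3) (LocalRing L v))
    (hθ : ∀ z, ((θ z).1.val : GL (Fin 3) (LocalRing L v)) = y * ((endoEmbLocal L v z.1).val : GL (Fin 3) (LocalRing L v)) * y⁻¹)
    (b : ↥(Subgroup.centralizer ({γ₀} : Set ((cmDatum L 3 H').Local v)))) :
    IsLocalNormPair L H' v (θ.symm b).1 b.1 :=
  isConj_iff.2 ⟨y, conj_endoEmbLocal_symm_eq_of_transport L H' v θ y hθ b⟩

/-- **Two box points matched by one `γ_H` coincide** under the chart's (SEP) «`GL`-conjugate box points are equal». [cite: Rogawski1990, §4.3 p. 43] -/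
theorem eq_of_isLocalNormPair_of_isLocalNormPair {γ₀ : (cmDatum L 3 H').Local v}
    {BG : Set ↥(Subgroup.centralizer ({γ₀} : Set ((cmDatum L 3 H').Local v)))}
    (hsepG : ∀ b ∈ BG, ∀ b' ∈ BG, IsConj (b.1.val : GL (Fin 3) (LocalRing L v)) b'.1.val → b = b')
    {a : (cmDatum L 2 (Matrix.of fun i j : Fin 2 => if i.val + j.val + 1 = 2 then (1 : L) else 0)).Local v ×
      (cmDatum L 1 (Matrix.of fun i j : Fin 1 => if i.val + j.val + 1 = 1 then (1 : L) else 0)).Local v}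
    {b b' : ↥(Subgroup.centralizer ({γ₀} : Set ((cmDatum L 3 H').Local v)))} (hb : b ∈ BG) (hb' : b' ∈ BG)
    (h : IsLocalNormPair L H' v a b.1) (h' : IsLocalNormPair L H' v a b'.1) : b = b' :=
  hsepG b hb b' hb' ((IsConj.symm h).trans h')

end MatchedCM

/-! ## §2 The matched chart at the CM carriers -/

section MatchedChartCM

variable (L : Type) [Field L] [NumberField L] [IsCMField L] (H' : Matrix (Fin 3) (Fin 3) L) (v : HeightOneSpectrum (𝓞 ↥(maximalRealSubfield L)))
  [MeasurableSpace ((cmDatum L 2 (Matrix.of fun i j : Fin 2 => if i.val + j.val + 1 = 2 then (1 : L) else 0)).Local v ×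
      (cmDatum L 1 (Matrix.of fun i j : Fin 1 => if i.val + j.val + 1 = 1 then (1 : L) else 0)).Local v)] [BorelSpace ((cmDatum L 2 (Matrix.of fun i j : Fin 2 => if i.val + j.val + 1 = 2 then (1 : L) else 0)).Local v ×
      (cmDatum L 1 (Matrix.of fun i j : Fin 1 => if i.val + j.val + 1 = 1 then (1 : L) else 0)).Local v)]
  [iM' : ∀ γ : (cmDatum L 3 H').Local v, MeasurableSpace ((cmDatum L 3 H').Local v ⧸ Subgroup.centralizer ({γ} : Set ((cmDatum L 3 H').Local v)))]
  [iH : ∀ a : ((cmDatum L 2 (Matrix.of fun i j : Fin 2 => if i.val + j.val + 1 = 2 then (1 : L) else 0)).Local v ×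
      (cmDatum L 1 (Matrix.of fun i j : Fin 1 => if i.val + j.val + 1 = 1 then (1 : L) else 0)).Local v), MeasurableSpace (((cmDatum L 2 (Matrix.of fun i j : Fin 2 => if i.val + j.val + 1 = 2 then (1 : L) else 0)).Local v ×
      (cmDatum L 1 (Matrix.of fun i j : Fin 1 => if i.val + j.val + 1 = 1 then (1 : L) else 0)).Local v) ⧸ Subgroup.centralizer ({a} : Set ((cmDatum L 2 (Matrix.of fun i j : Fin 2 => if i.val + j.val + 1 = 2 then (1 : L) else 0)).Local v ×
      (cmDatum L 1 (Matrix.of fun i j : Fin 1 => if i.val + j.val + 1 = 1 then (1 : L) else 0)).Local v)))]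
  [iHB : ∀ a : ((cmDatum L 2 (Matrix.of fun i j : Fin 2 => if i.val + j.val + 1 = 2 then (1 : L) else 0)).Local v ×
      (cmDatum L 1 (Matrix.of fun i j : Fin 1 => if i.val + j.val + 1 = 1 then (1 : L) else 0)).Local v), BorelSpace (((cmDatum L 2 (Matrix.of fun i j : Fin 2 => if i.val + j.val + 1 = 2 then (1 : L) else 0)).Local v ×
      (cmDatum L 1 (Matrix.of fun i j : Fin 1 => if i.val + j.val + 1 = 1 then (1 : L) else 0)).Local v) ⧸ Subgroup.centralizer ({a} : Set ((cmDatum L 2 (Matrix.of fun i j : Fin 2 => if i.val + j.val + 1 = 2 then (1 : L) else 0)).Local v ×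
      (cmDatum L 1 (Matrix.of fun i j : Fin 1 => if i.val + j.val + 1 = 1 then (1 : L) else 0)).Local v)))]

set_option maxHeartbeats 400000 in
/-- **THE MATCHED CHART AT A NON-SPLIT PLACE (Rogawski 1990 §4.3 ∕ §4.9 Prop. 4.9.1 (a), the (hloc) junction, design v2).**  Data: the explicit transfer factor
`Δ_v = (finExplicitCollection μ) v` (★ A5), a CANONICAL orbital measure family `mH` on `H_v` and any family `mG` on `G′_v`; a regular `γ₀ ∈ G′_v = U(H′)(L⁺_v)`; fibre representatives `S` of the norm
fibre over `γ₀` (★ `exists_finset_normFibre_card_le_three`: `G`-regular, matched, pairwise not stably conjugate, covering); for every `G`-regular `γ_H` an `H_v`-chart `e(a, t) = s(a)·t·s(a)⁻¹` on a box `K × B₁ ∋ (a₀, γ_H)` in TORUS COORDINATES with regularity, common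
centraliser, saturation and stable separation on `B₁` (`hchartH`, A-p16 (2ᵀ)); a `G′_v`-chart `e_G(a, b) = s_G(a)·b·s_G(a)⁻¹` around `γ₀` in the coordinates of
`T = Z_{G′_v}(γ₀)` with `s_G(a_G) = 1` and ARBITRARILY SMALL regular, `GL₃`-separated boxes (`hNG`, A-p16 (1ᵀ)); local constancy of `t ↦ Φ([t], ψ)` on the regular
part of `T` (`hOlcG`, F0P3a-p03 (G1-i)); and the UNIFORM FIBRE «every `G`-regular `a` matched with `t₁ ∈ T` is stably conjugate to the transport `θ_t⁻¹(t₁)` for some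
`t ∈ S`» (★ `exists_mem_forall_isLocalStablyConjH_of_conj_eq`, F0P3a-p08 (W2′)); the normalised torus measures on the `Z_H(t)` are ★
`exists_isHaarMeasure_isInvInvariant_compactCore_eq_one` (B-p04 (o3)).  CONCLUSION: an open `U ∋ γ₀` such that every `ψ ∈ C_c^∞(G′_v)` with `tsupport ψ ⊆ U` has a `C_c^∞` transfer `ψ^H`:
`IsLocalDeltaTransfer Δ_v mH mG ψ^H ψ` ((4.3.1) at every `G`-regular `γ_H`).
PROOF: transport each `Z_H(t)` (`t ∈ S`) onto `T` by ★ `exists_localEndoCentralizerEquiv` (`θ_t(z) = y_t ι(z) y_t⁻¹`), shrink the `G′`-box inside `⋂_t θ_t(B₁^{(t)})` and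
inside the open set where the `U(Φ₁)`-slots of the `θ_t⁻¹(b)` are pairwise distinct (★ `isLocalStablyConjH_iff_snd_eq_of_isLocalNormPair`), and feed ★
`exists_transfer_of_matchedChart` with `τ_t := θ_t⁻¹`: (N1)∕separation from the `GL₃`-separation of the box (§1), (N3) = ★ (W2′), realisation = ★
`IsCanonical.exists_isLocSmooth_stableOrbitalIntegralRel_eq_of_chart_comp`, `Δ`-constancy = ★ `finExplicitCollection_Δ_comp_eventually_eq` (+ ★
`isUnit_eval_finCharpolyTwo_of_isLocalGRegular`), `Δ` stable = ★ `finExplicitCollection_Δ_eq_of_isLocalStablyConjH`, additivity = ★ `localStableOrbitalIntegralH_add_of_isLocSmooth`.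
[cite: Rogawski1990, §4.3 (4.3.1)–(4.3.2) pp. 42–44; §4.9 Prop. 4.9.1 (a) pp. 54–55; §3.6 p. 31] [cite: LanglandsShelstad1987, §1.3] -/
theorem exists_localTransfer_of_matchedChart_nonsplit (hH' : (H'.map (cmConjRingHom L))ᵀ = H') (hdet' : H'.det ≠ 0) (μ : HeckeCharacter L)
    (hl : ∀ (v : HeightOneSpectrum (𝓞 ↥(maximalRealSubfield L))) (a : ((cmDatum L 2 (Matrix.of fun i j : Fin 2 => if i.val + j.val + 1 = 2 then (1 : L) else 0)).Local v ×
      (cmDatum L 1 (Matrix.of fun i j : Fin 1 => if i.val + j.val + 1 = 1 then (1 : L) else 0)).Local v)) (b : (cmDatum L 3 H').Local v) (x : ((cmDatum L 2 (Matrix.of fun i j : Fin 2 => if i.val + j.val + 1 = 2 then (1 : L) else 0)).Local v ×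
      (cmDatum L 1 (Matrix.of fun i j : Fin 1 => if i.val + j.val + 1 = 1 then (1 : L) else 0)).Local v)),
      finExplicitDelta L v H' (x * a * x⁻¹) μ b = finExplicitDelta L v H' a μ b)
    (hr : ∀ (v : HeightOneSpectrum (𝓞 ↥(maximalRealSubfield L))) (a : ((cmDatum L 2 (Matrix.of fun i j : Fin 2 => if i.val + j.val + 1 = 2 then (1 : L) else 0)).Local v ×
      (cmDatum L 1 (Matrix.of fun i j : Fin 1 => if i.val + j.val + 1 = 1 then (1 : L) else 0)).Local v)) (b y : (cmDatum L 3 H').Local v),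
      finExplicitDelta L v H' a μ (y * b * y⁻¹) = finExplicitDelta L v H' a μ b)
    (νH : Measure ((cmDatum L 2 (Matrix.of fun i j : Fin 2 => if i.val + j.val + 1 = 2 then (1 : L) else 0)).Local v ×
      (cmDatum L 1 (Matrix.of fun i j : Fin 1 => if i.val + j.val + 1 = 1 then (1 : L) else 0)).Local v)) [νH.IsHaarMeasure] [νH.IsMulRightInvariant]
    {mH : OrbitalMeasureFamily ((cmDatum L 2 (Matrix.of fun i j : Fin 2 => if i.val + j.val + 1 = 2 then (1 : L) else 0)).Local v ×
      (cmDatum L 1 (Matrix.of fun i j : Fin 1 => if i.val + j.val + 1 = 1 then (1 : L) else 0)).Local v)} {mG : OrbitalMeasureFamily ((cmDatum L 3 H').Local v)}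
    (hmH : mH.IsCanonical (IsLocalGRegular L v) νH)
    -- the regular base class and the fibre representatives (★ F1)
    (γ₀ : (cmDatum L 3 H').Local v) (hγ₀ : IsRegularElt (γ₀.val : GL (Fin 3) (LocalRing L v))) (S : Finset ((cmDatum L 2 (Matrix.of fun i j : Fin 2 => if i.val + j.val + 1 = 2 then (1 : L) else 0)).Local v ×
      (cmDatum L 1 (Matrix.of fun i j : Fin 1 => if i.val + j.val + 1 = 1 then (1 : L) else 0)).Local v))
    (hS1 : ∀ t ∈ S, IsLocalGRegular L v t ∧ IsLocalNormPair L H' v t γ₀)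
    (hS2 : ∀ t ∈ S, ∀ t' ∈ S, t ≠ t' → ¬ IsLocalStablyConjH L v t t')
    (hS3 : ∀ a, IsLocalGRegular L v a → IsLocalNormPair L H' v a γ₀ → ∃ t ∈ S, IsLocalStablyConjH L v a t)
    -- (2ᵀ) the `H_v`-charts in torus coordinates
    (hchartH : ∀ γH : ((cmDatum L 2 (Matrix.of fun i j : Fin 2 => if i.val + j.val + 1 = 2 then (1 : L) else 0)).Local v ×
      (cmDatum L 1 (Matrix.of fun i j : Fin 1 => if i.val + j.val + 1 = 1 then (1 : L) else 0)).Local v), IsLocalGRegular L v γH →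
      ∃ (A : Type) (_ : TopologicalSpace A) (s : A → ((cmDatum L 2 (Matrix.of fun i j : Fin 2 => if i.val + j.val + 1 = 2 then (1 : L) else 0)).Local v ×
      (cmDatum L 1 (Matrix.of fun i j : Fin 1 => if i.val + j.val + 1 = 1 then (1 : L) else 0)).Local v)) (e : OpenPartialHomeomorph (A × ↥(Subgroup.centralizer ({γH} : Set ((cmDatum L 2 (Matrix.of fun i j : Fin 2 => if i.val + j.val + 1 = 2 then (1 : L) else 0)).Local v ×
      (cmDatum L 1 (Matrix.of fun i j : Fin 1 => if i.val + j.val + 1 = 1 then (1 : L) else 0)).Local v)))) ((cmDatum L 2 (Matrix.of fun i j : Fin 2 => if i.val + j.val + 1 = 2 then (1 : L) else 0)).Local v ×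
      (cmDatum L 1 (Matrix.of fun i j : Fin 1 => if i.val + j.val + 1 = 1 then (1 : L) else 0)).Local v))
        (K : Set A) (B₁ : Set ↥(Subgroup.centralizer ({γH} : Set ((cmDatum L 2 (Matrix.of fun i j : Fin 2 => if i.val + j.val + 1 = 2 then (1 : L) else 0)).Local v ×
      (cmDatum L 1 (Matrix.of fun i j : Fin 1 => if i.val + j.val + 1 = 1 then (1 : L) else 0)).Local v)))) (a₀ : A) (b₀ : ↥(Subgroup.centralizer ({γH} : Set ((cmDatum L 2 (Matrix.of fun i j : Fin 2 => if i.val + j.val + 1 = 2 then (1 : L) else 0)).Local v ×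
      (cmDatum L 1 (Matrix.of fun i j : Fin 1 => if i.val + j.val + 1 = 1 then (1 : L) else 0)).Local v)))),
        Continuous s ∧ (∀ p ∈ e.source, e p = s p.1 * (p.2 : ((cmDatum L 2 (Matrix.of fun i j : Fin 2 => if i.val + j.val + 1 = 2 then (1 : L) else 0)).Local v ×
      (cmDatum L 1 (Matrix.of fun i j : Fin 1 => if i.val + j.val + 1 = 1 then (1 : L) else 0)).Local v)) * (s p.1)⁻¹) ∧ IsCompact K ∧ IsOpen K ∧ a₀ ∈ K ∧ IsOpen B₁ ∧
        (b₀ : ((cmDatum L 2 (Matrix.of fun i j : Fin 2 => if i.val + j.val + 1 = 2 then (1 : L) else 0)).Local v ×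
      (cmDatum L 1 (Matrix.of fun i j : Fin 1 => if i.val + j.val + 1 = 1 then (1 : L) else 0)).Local v)) = γH ∧ b₀ ∈ B₁ ∧ K ×ˢ B₁ ⊆ e.source ∧
        (∀ b ∈ B₁, IsLocalGRegular L v (b : ((cmDatum L 2 (Matrix.of fun i j : Fin 2 => if i.val + j.val + 1 = 2 then (1 : L) else 0)).Local v ×
      (cmDatum L 1 (Matrix.of fun i j : Fin 1 => if i.val + j.val + 1 = 1 then (1 : L) else 0)).Local v)) ∧
          Subgroup.centralizer ({(b : ((cmDatum L 2 (Matrix.of fun i j : Fin 2 => if i.val + j.val + 1 = 2 then (1 : L) else 0)).Local v ×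
      (cmDatum L 1 (Matrix.of fun i j : Fin 1 => if i.val + j.val + 1 = 1 then (1 : L) else 0)).Local v))} : Set ((cmDatum L 2 (Matrix.of fun i j : Fin 2 => if i.val + j.val + 1 = 2 then (1 : L) else 0)).Local v ×
      (cmDatum L 1 (Matrix.of fun i j : Fin 1 => if i.val + j.val + 1 = 1 then (1 : L) else 0)).Local v)) = Subgroup.centralizer ({γH} : Set ((cmDatum L 2 (Matrix.of fun i j : Fin 2 => if i.val + j.val + 1 = 2 then (1 : L) else 0)).Local v ×
      (cmDatum L 1 (Matrix.of fun i j : Fin 1 => if i.val + j.val + 1 = 1 then (1 : L) else 0)).Local v))) ∧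
        (∀ b ∈ B₁, ∀ x : ((cmDatum L 2 (Matrix.of fun i j : Fin 2 => if i.val + j.val + 1 = 2 then (1 : L) else 0)).Local v ×
      (cmDatum L 1 (Matrix.of fun i j : Fin 1 => if i.val + j.val + 1 = 1 then (1 : L) else 0)).Local v), x * (b : ((cmDatum L 2 (Matrix.of fun i j : Fin 2 => if i.val + j.val + 1 = 2 then (1 : L) else 0)).Local v ×
      (cmDatum L 1 (Matrix.of fun i j : Fin 1 => if i.val + j.val + 1 = 1 then (1 : L) else 0)).Local v)) * x⁻¹ ∈ e '' (K ×ˢ B₁) →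
          x ∈ s '' K * ((Subgroup.centralizer ({γH} : Set ((cmDatum L 2 (Matrix.of fun i j : Fin 2 => if i.val + j.val + 1 = 2 then (1 : L) else 0)).Local v ×
      (cmDatum L 1 (Matrix.of fun i j : Fin 1 => if i.val + j.val + 1 = 1 then (1 : L) else 0)).Local v)) : Subgroup ((cmDatum L 2 (Matrix.of fun i j : Fin 2 => if i.val + j.val + 1 = 2 then (1 : L) else 0)).Local v ×
      (cmDatum L 1 (Matrix.of fun i j : Fin 1 => if i.val + j.val + 1 = 1 then (1 : L) else 0)).Local v)) : Set ((cmDatum L 2 (Matrix.of fun i j : Fin 2 => if i.val + j.val + 1 = 2 then (1 : L) else 0)).Local v ×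
      (cmDatum L 1 (Matrix.of fun i j : Fin 1 => if i.val + j.val + 1 = 1 then (1 : L) else 0)).Local v))) ∧
        (∀ b ∈ B₁, ∀ b' ∈ B₁, IsLocalStablyConjH L v (b : ((cmDatum L 2 (Matrix.of fun i j : Fin 2 => if i.val + j.val + 1 = 2 then (1 : L) else 0)).Local v ×
      (cmDatum L 1 (Matrix.of fun i j : Fin 1 => if i.val + j.val + 1 = 1 then (1 : L) else 0)).Local v)) (b' : ((cmDatum L 2 (Matrix.of fun i j : Fin 2 => if i.val + j.val + 1 = 2 then (1 : L) else 0)).Local v ×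
      (cmDatum L 1 (Matrix.of fun i j : Fin 1 => if i.val + j.val + 1 = 1 then (1 : L) else 0)).Local v)) → b = b'))
    -- (1ᵀ) the `G′_v`-chart in the coordinates of `T = Z_{G′_v}(γ₀)`, with shrinking
    {AG : Type*} [TopologicalSpace AG] (sG : AG → (cmDatum L 3 H').Local v) (eG : OpenPartialHomeomorph (AG × ↥(Subgroup.centralizer ({γ₀} : Set ((cmDatum L 3 H').Local v)))) ((cmDatum L 3 H').Local v)) (aG : AG) (b₀G : ↥(Subgroup.centralizer ({γ₀} : Set ((cmDatum L 3 H').Local v))))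
    (heG : ∀ p ∈ eG.source, eG p = sG p.1 * (p.2 : (cmDatum L 3 H').Local v) * (sG p.1)⁻¹) (hsG : sG aG = 1) (hb₀G : (b₀G : (cmDatum L 3 H').Local v) = γ₀)
    (hNG : ∀ N ∈ 𝓝 (aG, b₀G), ∃ (K : Set AG) (B : Set ↥(Subgroup.centralizer ({γ₀} : Set ((cmDatum L 3 H').Local v)))), IsCompact K ∧ IsOpen K ∧ aG ∈ K ∧ IsCompact B ∧ IsOpen B ∧ b₀G ∈ B ∧
      K ×ˢ B ⊆ N ∧ K ×ˢ B ⊆ eG.source ∧ (∀ b ∈ B, IsRegularElt ((b : (cmDatum L 3 H').Local v).val : GL (Fin 3) (LocalRing L v))) ∧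
      (∀ b ∈ B, ∀ b' ∈ B, IsConj ((b : (cmDatum L 3 H').Local v).val : GL (Fin 3) (LocalRing L v)) (b' : (cmDatum L 3 H').Local v).val → b = b'))
    -- (G1-i) local constancy of the regular orbital integrals along `T`
    (hOlcG : ∀ ψ : (cmDatum L 3 H').Local v → ℂ, IsLocSmooth ψ → ∀ t₀ : ↥(Subgroup.centralizer ({γ₀} : Set ((cmDatum L 3 H').Local v))), IsRegularElt (((t₀ : (cmDatum L 3 H').Local v)).val : GL (Fin 3) (LocalRing L v)) →
      ∀ᶠ t : ↥(Subgroup.centralizer ({γ₀} : Set ((cmDatum L 3 H').Local v))) in 𝓝 t₀, classOrbitalIntegral mG ψ (ConjClasses.mk (t : (cmDatum L 3 H').Local v)) = classOrbitalIntegral mG ψ (ConjClasses.mk (t₀ : (cmDatum L 3 H').Local v))) :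
    ∃ U : Set ((cmDatum L 3 H').Local v), IsOpen U ∧ γ₀ ∈ U ∧ ∀ ψ : (cmDatum L 3 H').Local v → ℂ, IsLocSmooth ψ → tsupport ψ ⊆ U →
      ∃ ψH : ((cmDatum L 2 (Matrix.of fun i j : Fin 2 => if i.val + j.val + 1 = 2 then (1 : L) else 0)).Local v ×
      (cmDatum L 1 (Matrix.of fun i j : Fin 1 => if i.val + j.val + 1 = 1 then (1 : L) else 0)).Local v) → ℂ, IsLocSmooth ψH ∧ IsLocalDeltaTransfer L H' v ((finExplicitCollection L H' μ hl hr) v) mH mG ψH ψ := by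
  classical
  -- the transports `θ_t : Z_H(t) ≃ Z_{G′}(γ₀)` (★ (Θ)) with their conjugators `y_t`
  have hΘ : ∀ j : ↥S, ∃ (y : GL (Fin 3) (LocalRing L v)) (θ : ↥(Subgroup.centralizer ({(j : ((cmDatum L 2 (Matrix.of fun i j : Fin 2 => if i.val + j.val + 1 = 2 then (1 : L) else 0)).Local v ×
      (cmDatum L 1 (Matrix.of fun i j : Fin 1 => if i.val + j.val + 1 = 1 then (1 : L) else 0)).Local v))} : Set ((cmDatum L 2 (Matrix.of fun i j : Fin 2 => if i.val + j.val + 1 = 2 then (1 : L) else 0)).Local v ×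
      (cmDatum L 1 (Matrix.of fun i j : Fin 1 => if i.val + j.val + 1 = 1 then (1 : L) else 0)).Local v))) ≃ₜ* ↥(Subgroup.centralizer ({γ₀} : Set ((cmDatum L 3 H').Local v)))),
      y * ((endoEmbLocal L v (j : ((cmDatum L 2 (Matrix.of fun i j : Fin 2 => if i.val + j.val + 1 = 2 then (1 : L) else 0)).Local v ×
      (cmDatum L 1 (Matrix.of fun i j : Fin 1 => if i.val + j.val + 1 = 1 then (1 : L) else 0)).Local v))).val : GL (Fin 3) (LocalRing L v)) * y⁻¹ = γ₀.val ∧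
      ∀ z, ((θ z).1.val : GL (Fin 3) (LocalRing L v)) = y * ((endoEmbLocal L v z.1).val : GL (Fin 3) (LocalRing L v)) * y⁻¹ := by
    intro j
    obtain ⟨hreg, hm⟩ := hS1 j.1 j.2
    obtain ⟨y, hy⟩ := isConj_iff.1 hm
    obtain ⟨θ, hθ⟩ := exists_localEndoCentralizerEquiv L v hdet' hreg hm
    exact ⟨y, θ, hy, hθ y hy⟩
  choose y θ hy hθ using hΘ
  -- the `H_v`-charts at the representatives, and the torus measures
  have hC := fun j : ↥S => hchartH (j : ((cmDatum L 2 (Matrix.of fun i j : Fin 2 => if i.val + j.val + 1 = 2 then (1 : L) else 0)).Local v ×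
      (cmDatum L 1 (Matrix.of fun i j : Fin 1 => if i.val + j.val + 1 = 1 then (1 : L) else 0)).Local v)) (hS1 j.1 j.2).1
  choose A tA s e K B₁ a₀ b₀ hs he hKc hKo ha₀ hB₁o hb₀ hb₀B hKB hregH hsatH hsepH using hC
  have hρ' := fun j : ↥S => (exists_isHaarMeasure_isInvInvariant_compactCore_eq_one L v (j : ((cmDatum L 2 (Matrix.of fun i j : Fin 2 => if i.val + j.val + 1 = 2 then (1 : L) else 0)).Local v ×
      (cmDatum L 1 (Matrix.of fun i j : Fin 1 => if i.val + j.val + 1 = 1 then (1 : L) else 0)).Local v)) (hS1 j.1 j.2).1).2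
  choose ρ hρH hρI hρ1 using hρ'
  have hTc := fun j : ↥S => (exists_isHaarMeasure_isInvInvariant_compactCore_eq_one L v (j : ((cmDatum L 2 (Matrix.of fun i j : Fin 2 => if i.val + j.val + 1 = 2 then (1 : L) else 0)).Local v ×
      (cmDatum L 1 (Matrix.of fun i j : Fin 1 => if i.val + j.val + 1 = 1 then (1 : L) else 0)).Local v)) (hS1 j.1 j.2).1).1
  -- matching along the transports, and the base point
  have hmatch : ∀ j (b : ↥(Subgroup.centralizer ({γ₀} : Set ((cmDatum L 3 H').Local v)))), IsLocalNormPair L H' v ((θ j).symm b : ((cmDatum L 2 (Matrix.of fun i j : Fin 2 => if i.val + j.val + 1 = 2 then (1 : L) else 0)).Local v ×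
      (cmDatum L 1 (Matrix.of fun i j : Fin 1 => if i.val + j.val + 1 = 1 then (1 : L) else 0)).Local v)) (b : (cmDatum L 3 H').Local v) :=
    fun j b => isLocalNormPair_symm_of_transport L H' v (θ j) (y j) (hθ j) b
  have hθb : ∀ j, θ j (b₀ j) = b₀G := by
    intro j
    apply Subtype.ext
    apply Subtype.ext
    rw [hθ j (b₀ j), hb₀ j, hb₀G]
    exact hy j
  have hθb' : ∀ j, (θ j).symm b₀G = b₀ j := fun j => by rw [← hθb j, ContinuousMulEquiv.symm_apply_apply]
  -- the shrinking target: inside every transported `H`-box, with pairwise distinct `U(Φ₁)`-slots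
  have hW : {b : ↥(Subgroup.centralizer ({γ₀} : Set ((cmDatum L 3 H').Local v))) | (∀ j, b ∈ (θ j) '' B₁ j) ∧
      ∀ j j', j ≠ j' → ((θ j).symm b : ((cmDatum L 2 (Matrix.of fun i j : Fin 2 => if i.val + j.val + 1 = 2 then (1 : L) else 0)).Local v ×
      (cmDatum L 1 (Matrix.of fun i j : Fin 1 => if i.val + j.val + 1 = 1 then (1 : L) else 0)).Local v)).2 ≠ ((θ j').symm b : ((cmDatum L 2 (Matrix.of fun i j : Fin 2 => if i.val + j.val + 1 = 2 then (1 : L) else 0)).Local v ×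
      (cmDatum L 1 (Matrix.of fun i j : Fin 1 => if i.val + j.val + 1 = 1 then (1 : L) else 0)).Local v)).2} ∈ 𝓝 b₀G := by
    have h1 : ∀ᶠ b in 𝓝 b₀G, ∀ j, b ∈ (θ j) '' B₁ j :=
      eventually_all.2 fun j => ((θ j).toHomeomorph.isOpenMap _ (hB₁o j)).mem_nhds ⟨b₀ j, hb₀B j, hθb j⟩
    have h2 : ∀ᶠ b in 𝓝 b₀G, ∀ j j', j ≠ j' → ((θ j).symm b : ((cmDatum L 2 (Matrix.of fun i j : Fin 2 => if i.val + j.val + 1 = 2 then (1 : L) else 0)).Local v ×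
      (cmDatum L 1 (Matrix.of fun i j : Fin 1 => if i.val + j.val + 1 = 1 then (1 : L) else 0)).Local v)).2 ≠ ((θ j').symm b : ((cmDatum L 2 (Matrix.of fun i j : Fin 2 => if i.val + j.val + 1 = 2 then (1 : L) else 0)).Local v ×
      (cmDatum L 1 (Matrix.of fun i j : Fin 1 => if i.val + j.val + 1 = 1 then (1 : L) else 0)).Local v)).2 := by
      refine eventually_all.2 fun j => eventually_all.2 fun j' => ?_
      by_cases hjj : j = j'
      · exact Eventually.of_forall fun b h => (h hjj).elim
      · have hop : IsOpen {b : ↥(Subgroup.centralizer ({γ₀} : Set ((cmDatum L 3 H').Local v))) | ((θ j).symm b : ((cmDatum L 2 (Matrix.of fun i j : Fin 2 => if i.val + j.val + 1 = 2 then (1 : L) else 0)).Local v ×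
      (cmDatum L 1 (Matrix.of fun i j : Fin 1 => if i.val + j.val + 1 = 1 then (1 : L) else 0)).Local v)).2 ≠ ((θ j').symm b : ((cmDatum L 2 (Matrix.of fun i j : Fin 2 => if i.val + j.val + 1 = 2 then (1 : L) else 0)).Local v ×
      (cmDatum L 1 (Matrix.of fun i j : Fin 1 => if i.val + j.val + 1 = 1 then (1 : L) else 0)).Local v)).2} :=
          isOpen_ne_fun (continuous_snd.comp (continuous_subtype_val.comp (θ j).symm.continuous))
            (continuous_snd.comp (continuous_subtype_val.comp (θ j').symm.continuous))
        have h0 : ((θ j).symm b₀G : ((cmDatum L 2 (Matrix.of fun i j : Fin 2 => if i.val + j.val + 1 = 2 then (1 : L) else 0)).Local v ×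
      (cmDatum L 1 (Matrix.of fun i j : Fin 1 => if i.val + j.val + 1 = 1 then (1 : L) else 0)).Local v)).2 ≠ ((θ j').symm b₀G : ((cmDatum L 2 (Matrix.of fun i j : Fin 2 => if i.val + j.val + 1 = 2 then (1 : L) else 0)).Local v ×
      (cmDatum L 1 (Matrix.of fun i j : Fin 1 => if i.val + j.val + 1 = 1 then (1 : L) else 0)).Local v)).2 := by
          rw [hθb' j, hθb' j', hb₀ j, hb₀ j']
          intro hEq
          exact hS2 j.1 j.2 j'.1 j'.2 (fun h => hjj (Subtype.ext h))
            ((isLocalStablyConjH_iff_snd_eq_of_isLocalNormPair L H' v (hS1 j.1 j.2).1 (hS1 j.1 j.2).2 (hS1 j'.1 j'.2).2).2 hEq)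
        have hev : ∀ᶠ b in 𝓝 b₀G, ((θ j).symm b : ((cmDatum L 2 (Matrix.of fun i j : Fin 2 => if i.val + j.val + 1 = 2 then (1 : L) else 0)).Local v ×
      (cmDatum L 1 (Matrix.of fun i j : Fin 1 => if i.val + j.val + 1 = 1 then (1 : L) else 0)).Local v)).2 ≠ ((θ j').symm b : ((cmDatum L 2 (Matrix.of fun i j : Fin 2 => if i.val + j.val + 1 = 2 then (1 : L) else 0)).Local v ×
      (cmDatum L 1 (Matrix.of fun i j : Fin 1 => if i.val + j.val + 1 = 1 then (1 : L) else 0)).Local v)).2 := hop.mem_nhds h0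
        exact hev.mono fun b hb _ => hb
    exact h1.and h2
  obtain ⟨KG, BG, hKGc, hKGo, haG, hBGc, hBGo, hb₀BG, hNB, hKBG, hregG, hsepG⟩ := hNG _ (prod_mem_nhds univ_mem hW)
  have hBW : ∀ b ∈ BG, (∀ j, b ∈ (θ j) '' B₁ j) ∧
      ∀ j j', j ≠ j' → ((θ j).symm b : ((cmDatum L 2 (Matrix.of fun i j : Fin 2 => if i.val + j.val + 1 = 2 then (1 : L) else 0)).Local v ×
      (cmDatum L 1 (Matrix.of fun i j : Fin 1 => if i.val + j.val + 1 = 1 then (1 : L) else 0)).Local v)).2 ≠ ((θ j').symm b : ((cmDatum L 2 (Matrix.of fun i j : Fin 2 => if i.val + j.val + 1 = 2 then (1 : L) else 0)).Local v ×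
      (cmDatum L 1 (Matrix.of fun i j : Fin 1 => if i.val + j.val + 1 = 1 then (1 : L) else 0)).Local v)).2 :=
    fun b hb => (hNB (Set.mk_mem_prod haG hb)).2
  have hsymB : ∀ j, ∀ b ∈ BG, (θ j).symm b ∈ B₁ j := by
    intro j b hb
    obtain ⟨b', hb', rfl⟩ := (hBW b hb).1 j
    rw [ContinuousMulEquiv.symm_apply_apply]
    exact hb'
  have hregτ : ∀ j, ∀ b ∈ BG, IsLocalGRegular L v ((θ j).symm b : ((cmDatum L 2 (Matrix.of fun i j : Fin 2 => if i.val + j.val + 1 = 2 then (1 : L) else 0)).Local v ×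
      (cmDatum L 1 (Matrix.of fun i j : Fin 1 => if i.val + j.val + 1 = 1 then (1 : L) else 0)).Local v)) :=
    fun j b hb => (hregH j _ (hsymB j b hb)).1
  -- the open set
  refine ⟨eG '' (KG ×ˢ BG), eG.isOpen_image_of_subset_source (hKGo.prod hBGo) hKBG,
    ⟨(aG, b₀G), Set.mk_mem_prod haG hb₀BG, ?_⟩, fun ψ hψ hψU => ?_⟩
  · rw [heG _ (hKBG (Set.mk_mem_prod haG hb₀BG)), hsG, hb₀G, one_mul, inv_one, mul_one]
  -- ★ the matched chart
  refine exists_transfer_of_matchedChart (R := IsLocalNormPair L H' v) (stA := IsLocalStablyConjH L v) (regA := IsLocalGRegular L v)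
    (T := (finExplicitCollection L H' μ hl hr) v) (mH := mH) (mG := mG)
    (fun _ _ h => IsStablyConjH.symm h) (fun _ _ _ h h' => IsStablyConjH.trans h h')
    (fun a a' b h => finExplicitCollection_Δ_eq_of_isLocalStablyConjH L v H' μ hl hr h b)
    (fun a γ y' h => (isLocalNormPair_conj_right L v H' a γ y').2 h)
    (fun a ha F G hF hG => localStableOrbitalIntegralH_add_of_isLocSmooth L v
      (OrbitalMeasureFamily.IsCanonical.isAdmissibleOn hmH) a ha F G hF hG)
    eG sG Subtype.val heG hKGc hBGc hBGo hBGc.isClosed hKBG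
    (fun (j : ↥S) (b : ↥(Subgroup.centralizer ({γ₀} : Set ((cmDatum L 3 H').Local v)))) => ((θ j).symm b : ((cmDatum L 2 (Matrix.of fun i j : Fin 2 => if i.val + j.val + 1 = 2 then (1 : L) else 0)).Local v ×
      (cmDatum L 1 (Matrix.of fun i j : Fin 1 => if i.val + j.val + 1 = 1 then (1 : L) else 0)).Local v))) hregτ
    ?_ ?_ ?_ ?_ ψ (fun x hx => image_eq_zero_of_notMem_tsupport fun h => hx (hψU h)) (fun b hb => hOlcG ψ hψ b (hregG b hb)) ?_
  · -- (hsepJ) different boxes are stably separated: equal slots would force equal base points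
    intro j j' hjj b hb b' hb' hst
    have h1 : IsLocalNormPair L H' v ((θ j).symm b : ((cmDatum L 2 (Matrix.of fun i j : Fin 2 => if i.val + j.val + 1 = 2 then (1 : L) else 0)).Local v ×
      (cmDatum L 1 (Matrix.of fun i j : Fin 1 => if i.val + j.val + 1 = 1 then (1 : L) else 0)).Local v)) (b' : (cmDatum L 3 H').Local v) :=
      (isLocalNormPair_iff_of_isLocalStablyConjH L v H' hst (b' : (cmDatum L 3 H').Local v)).1 (hmatch j' b')
    have hbb : b = b' := eq_of_isLocalNormPair_of_isLocalNormPair L H' v hsepG hb hb' (hmatch j b) h1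
    subst hbb
    exact (hBW b hb).2 j j' hjj hst.snd_eq
  · -- (hrealJ) realisation on each transported box (★ `…_of_chart_comp` with `φ := θ_j⁻¹`)
    intro j g hg
    haveI := hρH j
    haveI := hρI j
    exact OrbitalMeasureFamily.IsCanonical.exists_isLocSmooth_stableOrbitalIntegralRel_eq_of_chart_comp
      (fun g x hg => isLocalGRegular_of_isConj (isConj_iff.2 ⟨x, rfl⟩) hg) hmH
      (Subgroup.centralizer ({(j : ((cmDatum L 2 (Matrix.of fun i j : Fin 2 => if i.val + j.val + 1 = 2 then (1 : L) else 0)).Local v ×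
      (cmDatum L 1 (Matrix.of fun i j : Fin 1 => if i.val + j.val + 1 = 1 then (1 : L) else 0)).Local v))} : Set ((cmDatum L 2 (Matrix.of fun i j : Fin 2 => if i.val + j.val + 1 = 2 then (1 : L) else 0)).Local v ×
      (cmDatum L 1 (Matrix.of fun i j : Fin 1 => if i.val + j.val + 1 = 1 then (1 : L) else 0)).Local v))) (hTc j) (ρ j) (hρ1 j)
      (e j) (s j) (hs j) Subtype.val (he j) (hKc j) (hKo j) (ha₀ j) (hKB j) (hregH j) (hsatH j)
      (IsLocalStablyConjH L v) (fun a x => isStablyConjH_of_isConj (isConj_iff.2 ⟨x, rfl⟩))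
      (fun _ _ h => IsStablyConjH.symm h) (fun _ _ _ h h' => IsStablyConjH.trans h h') (hsepH j)
      (θ j).symm.toHomeomorph hBGc hBGo (by rintro _ ⟨b, hb, rfl⟩; exact hsymB j b hb) g hg
  · -- (hdiag) two box points matched by one `γ_H` coincide
    exact fun j b hb b'' hb'' h => (eq_of_isLocalNormPair_of_isLocalNormPair L H' v hsepG hb hb'' (hmatch j b) h).symm
  · -- (hfib) the uniform fibre ★ (W2′)
    intro a ha b'' hb'' hR
    obtain ⟨t, htS, hfib⟩ := exists_mem_forall_isLocalStablyConjH_of_conj_eq L H' v hdet' γ₀ hγ₀ S hS3 b''.2 ha hR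
    exact ⟨⟨t, htS⟩, hfib (y ⟨t, htS⟩) (hy ⟨t, htS⟩) _
      (conj_endoEmbLocal_symm_eq_of_transport L H' v (θ ⟨t, htS⟩) (y ⟨t, htS⟩) (hθ ⟨t, htS⟩) b'')⟩
  · -- (hΔlc) ★ (G1-ii)
    intro j b hb
    have hev := finExplicitCollection_Δ_comp_eventually_eq L v H' hH' hdet' μ hl hr
      (τH := fun b : ↥(Subgroup.centralizer ({γ₀} : Set ((cmDatum L 3 H').Local v))) => ((θ j).symm b : ((cmDatum L 2 (Matrix.of fun i j : Fin 2 => if i.val + j.val + 1 = 2 then (1 : L) else 0)).Local v ×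
      (cmDatum L 1 (Matrix.of fun i j : Fin 1 => if i.val + j.val + 1 = 1 then (1 : L) else 0)).Local v))) (τG := (Subtype.val : ↥(Subgroup.centralizer ({γ₀} : Set ((cmDatum L 3 H').Local v))) → (cmDatum L 3 H').Local v))
      (continuous_subtype_val.comp (θ j).symm.continuous) continuous_subtype_val (B₁ := BG)
      (fun b _ => hmatch j b) hb (isUnit_eval_finCharpolyTwo_of_isLocalGRegular L v _ (hregτ j b hb))
    exact (hev.and (hBGo.mem_nhds hb)).mono fun b' h => h.1 h.2

end MatchedChartCM

end Literature.NumberTheory.Rogawski1990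

end
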